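import Summits.NavierStokesRegularity.FunctionalMining.TopEigSmoothEigenpair
import HarnessLib

/-!
# FunctionalMining — a simple top eigenvalue stays simple and top along its smooth continuation;
# the derivatives of `θ ↦ λ₁(S(θ))` at a simple point (F1 PART I, Proposition 3 along a line, for `λ₁`
# itself)

Search for candidate a priori estimates; no regularity claim. Cell `pub-nsfunc`, prove seat
(gen 22). `TopEigSmoothEigenpair.lean` continues a simple top eigenpair `(e, λ)` of `S(θ₀)` (gap form,
gap `g > 0`) to a local `C^∞` eigenpair `(N(θ), Λ(θ))`. Here: for `θ` near `θ₀` the continued pair IS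
the top pair of `S(θ)` — `Λ(θ) = λ₁(S(θ))`, `N(θ) ∈ E(S(θ))`, with a gap `≥ g/2` — so that the
function `θ ↦ λ₁(S(θ))` itself is `C^∞` near `θ₀` with the Hellmann–Feynman / second-derivative
formulas of `TopEigDensityLine.lean`.

* `TopEig.abs_ray_le_sum_abs` — `|wᵀMw| ≤ (∑ᵢⱼ |Mᵢⱼ|)|w|²` (entrywise smallness controls the form);
* `TopEig.ray_perp_le_near` — algebra of persistence: if `S₀e = λe` with gap `g` on `e^⊥`, `SN = ΛN`,
  `|N| = |e| = 1`, `wᵀ(S − S₀)w ≤ η|w|²` and `|N − e|² ≤ δ`, then `wᵀSw ≤ (λ − g + gδ + η)|w|²` on `N^⊥`;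
* `TopEig.lam1_eq_of_near` — if moreover `λ − g + gδ + η ≤ Λ` then `λ₁(S) = Λ` and `N ∈ E(S)`;
* **`TopEig.eventually_top_eigenpair`** — for the continuation of `TopEigSmoothEigenpair`:
  `∀ᶠ θ, Λ(θ) = λ₁(S(θ)) ∧ N(θ) ∈ E(S(θ))` and the gap form with gap `g/2` at `N(θ)`;
* **`TopEig.hasDerivAt_lam1_of_gapForm`** — `θ ↦ λ₁(S(θ))` has derivative `eᵀS′(θ₀)e` at `θ₀` and its
  derivative has derivative `eᵀS″e + 2N′ᵀS′e` there (`N′ᵀS′e ≥ 0`): PROP. 3 along a line for `λ₁`.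

[ours; folklore — Kato II-§5 (continuity of a simple eigenvalue's isolation)]
-/

noncomputable section

open Filter Topology Matrix
open scoped ContDiff

namespace Summit.NavierStokesRegularity.FunctionalMining

namespace TopEig

open SharpClass.DirectorForm

/-! ## 1. Entrywise smallness controls the quadratic form -/

/-- `|wᵢ wⱼ| ≤ |w|²`. [folklore] -/
theorem abs_mul_le_dotProduct_self {d : Type*} [Fintype d] (w : d → ℝ) (i j : d) :
    |w i * w j| ≤ w ⬝ᵥ w := by
  have hi : w i ^ 2 ≤ w ⬝ᵥ w := by
    simp only [dotProduct, ← pow_two]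
    exact Finset.single_le_sum (fun k _ => sq_nonneg (w k)) (Finset.mem_univ i)
  have hj : w j ^ 2 ≤ w ⬝ᵥ w := by
    simp only [dotProduct, ← pow_two]
    exact Finset.single_le_sum (fun k _ => sq_nonneg (w k)) (Finset.mem_univ j)
  rw [abs_mul]
  nlinarith [sq_abs (w i), sq_abs (w j), abs_nonneg (w i), abs_nonneg (w j),
    sq_nonneg (|w i| - |w j|)]

/-- **`|wᵀ M w| ≤ (∑ᵢⱼ |Mᵢⱼ|) |w|²`.** [folklore] -/
theorem abs_ray_le_sum_abs {d : Type*} [Fintype d] (M : Matrix d d ℝ) (w : d → ℝ) :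
    |w ⬝ᵥ M *ᵥ w| ≤ (∑ i, ∑ j, |M i j|) * (w ⬝ᵥ w) := by
  rw [dotProduct_mulVec_eq_sum_sum, Finset.sum_mul]
  refine (Finset.abs_sum_le_sum_abs _ _).trans (Finset.sum_le_sum fun i _ => ?_)
  rw [Finset.sum_mul]
  refine (Finset.abs_sum_le_sum_abs _ _).trans (Finset.sum_le_sum fun j _ => ?_)
  rw [show w i * M i j * w j = M i j * (w i * w j) by ring, abs_mul]
  exact mul_le_mul_of_nonneg_left (abs_mul_le_dotProduct_self w i j) (abs_nonneg _)

/-! ## 2. The algebra of persistence -/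

section Algebra

variable {d : Type*} [Fintype d] [DecidableEq d] [Nonempty d]

omit [DecidableEq d] [Nonempty d] in
/-- **Persistence, algebraic step.** `S₀ e = λ e`, `|e| = 1`, gap `g` on `e^⊥` for the symmetric
`S₀`; a vector `N` with `|N − e|² ≤ δ`; `wᵀ(S − S₀)w ≤ η|w|²` for all `w`. Then
`wᵀ S w ≤ (λ − g + gδ + η)|w|²` for every `w ⊥ N`. [folklore] -/
theorem ray_perp_le_near {S₀ S : Matrix d d ℝ} (hS₀ : S₀.IsSymm) {e N : d → ℝ} {lam g η δ : ℝ}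
    (he1 : e ⬝ᵥ e = 1) (hSe : S₀ *ᵥ e = lam • e) (hg : 0 ≤ g)
    (hgap : ∀ v, v ⬝ᵥ e = 0 → v ⬝ᵥ S₀ *ᵥ v ≤ (lam - g) * (v ⬝ᵥ v))
    (hη : ∀ w, w ⬝ᵥ (S - S₀) *ᵥ w ≤ η * (w ⬝ᵥ w))
    (hδ : (N - e) ⬝ᵥ (N - e) ≤ δ) {w : d → ℝ} (hw : w ⬝ᵥ N = 0) :
    w ⬝ᵥ S *ᵥ w ≤ (lam - g + g * δ + η) * (w ⬝ᵥ w) := by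
  -- split `w = w′ + b e`, `b = w·e`, `w′ ⊥ e`
  set b := w ⬝ᵥ e with hb
  set w' := w - b • e with hw'
  have hw'e : w' ⬝ᵥ e = 0 := by
    rw [hw', sub_dotProduct, smul_dotProduct, he1, smul_eq_mul, mul_one, hb, sub_self]
  have hw_eq : w = w' + b • e := by rw [hw']; abel
  have hew' : e ⬝ᵥ w' = 0 := by rw [dotProduct_comm]; exact hw'e
  have hww : w ⬝ᵥ w = w' ⬝ᵥ w' + b ^ 2 := by
    calc w ⬝ᵥ w = (w' + b • e) ⬝ᵥ (w' + b • e) := by rw [← hw_eq]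
      _ = w' ⬝ᵥ w' + b * (w' ⬝ᵥ e) + b * (e ⬝ᵥ w') + b * b * (e ⬝ᵥ e) := by
          simp only [add_dotProduct, dotProduct_add, smul_dotProduct, dotProduct_smul, smul_eq_mul]
          ring
      _ = w' ⬝ᵥ w' + b ^ 2 := by rw [hw'e, hew', he1]; ring
  -- `wᵀ S₀ w = w′ᵀ S₀ w′ + b² λ`
  have heSe : e ⬝ᵥ S₀ *ᵥ e = lam := by rw [hSe, dotProduct_smul, he1, smul_eq_mul, mul_one]
  have hcross : w' ⬝ᵥ S₀ *ᵥ e = 0 := by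
    rw [hSe, dotProduct_smul, hw'e, smul_zero]
  have hcross' : e ⬝ᵥ S₀ *ᵥ w' = 0 := by
    rw [dotProduct_mulVec_comm_of_isSymm hS₀, hcross]
  have hS₀w : w ⬝ᵥ S₀ *ᵥ w = w' ⬝ᵥ S₀ *ᵥ w' + b ^ 2 * lam := by
    calc w ⬝ᵥ S₀ *ᵥ w = (w' + b • e) ⬝ᵥ S₀ *ᵥ (w' + b • e) := by rw [← hw_eq]
      _ = w' ⬝ᵥ S₀ *ᵥ w' + b * (w' ⬝ᵥ S₀ *ᵥ e) + b * (e ⬝ᵥ S₀ *ᵥ w') +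
            b * b * (e ⬝ᵥ S₀ *ᵥ e) := by
          simp only [Matrix.mulVec_add, Matrix.mulVec_smul, add_dotProduct, dotProduct_add,
            smul_dotProduct, dotProduct_smul, smul_eq_mul]
          ring
      _ = w' ⬝ᵥ S₀ *ᵥ w' + b ^ 2 * lam := by rw [hcross, hcross', heSe]; ring
  -- `b = w·(e − N)` so `b² ≤ |w|² δ`
  have hb' : b = -(w ⬝ᵥ (N - e)) := by rw [dotProduct_sub, hw, zero_sub, neg_neg]
  have hb2 : b ^ 2 ≤ (w ⬝ᵥ w) * δ := by
    have hCS : (w ⬝ᵥ (N - e)) ^ 2 ≤ (w ⬝ᵥ w) * ((N - e) ⬝ᵥ (N - e)) := by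
      have h := Finset.sum_mul_sq_le_sq_mul_sq Finset.univ w (N - e)
      simp only [dotProduct, ← pow_two] at h ⊢
      exact h
    rw [hb', neg_sq]
    exact hCS.trans (mul_le_mul_of_nonneg_left hδ (dotProduct_self_nonneg' w))
  have h1 := hgap w' hw'e
  have h2 := hη w
  rw [Matrix.sub_mulVec, dotProduct_sub] at h2
  have hw'w' : w' ⬝ᵥ w' = w ⬝ᵥ w - b ^ 2 := by linarith
  rw [hw'w'] at h1
  nlinarith [h1, h2, hb2, hg, dotProduct_self_nonneg' w, sq_nonneg b]

/-- **Persistence, conclusion.** If moreover `λ − g + gδ + η ≤ Λ` then `λ₁(S) = Λ`, `N ∈ E(S)`, and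
the gap form holds at `N` with gap `Λ − (λ − g + gδ + η)`. [folklore] -/
theorem lam1_eq_of_near {S₀ S : Matrix d d ℝ} (hS₀ : S₀.IsSymm) (hS : S.IsSymm) {e N : d → ℝ}
    {lam g Λ η δ : ℝ} (he1 : e ⬝ᵥ e = 1) (hSe : S₀ *ᵥ e = lam • e) (hg : 0 ≤ g)
    (hgap : ∀ v, v ⬝ᵥ e = 0 → v ⬝ᵥ S₀ *ᵥ v ≤ (lam - g) * (v ⬝ᵥ v))
    (hN1 : N ⬝ᵥ N = 1) (hSN : S *ᵥ N = Λ • N) (hη : ∀ w, w ⬝ᵥ (S - S₀) *ᵥ w ≤ η * (w ⬝ᵥ w))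
    (hδ : (N - e) ⬝ᵥ (N - e) ≤ δ) (hle : lam - g + g * δ + η ≤ Λ) :
    lam1 S = Λ ∧ N ∈ topEigSet (flat S) ∧
      ∀ w, w ⬝ᵥ N = 0 → w ⬝ᵥ S *ᵥ w ≤ (Λ - (Λ - (lam - g + g * δ + η))) * (w ⬝ᵥ w) := by
  have hperp : ∀ w, w ⬝ᵥ N = 0 → w ⬝ᵥ S *ᵥ w ≤ (lam - g + g * δ + η) * (w ⬝ᵥ w) :=
    fun w hw => ray_perp_le_near hS₀ he1 hSe hg hgap hη hδ hw
  have hN1' : N ∈ unitSphere d := hN1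
  -- gap form at `N` for `S` with `μ := Λ − (λ − g + gδ + η) ≥ 0`
  have hgapN := gapForm_of_eigenvector hS hN1' hSN (μ := Λ - (lam - g + g * δ + η))
    (fun w hw => by have := hperp w hw; linarith [this])
  have hNS : quad (flat S) N = Λ := by
    rw [quad_flat, hSN, dotProduct_smul, hN1, smul_eq_mul, mul_one]
  have hμ : 0 ≤ Λ - (lam - g + g * δ + η) := by linarith
  refine ⟨lam_eq_of_gapForm hN1' hμ hgapN hNS, mem_topEigSet_of_gapForm hN1' hμ hgapN hNS,
    fun w hw => ?_⟩
  have := hperp w hw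
  linarith

end Algebra

/-! ## 3. Persistence along the smooth continuation; derivatives of `θ ↦ λ₁(S(θ))` -/

/-- **THE CONTINUED EIGENPAIR IS THE TOP PAIR NEARBY.** Under the hypotheses of
`exists_contDiffAt_top_eigenpair` (entrywise `C^∞` symmetric family, simple top at `θ₀` in gap
form with gap `g > 0`) and for its output `(N, Λ)`: for `θ` near `θ₀`, `λ₁(S(θ)) = Λ(θ)`,
`N(θ) ∈ E(S(θ))`, and the gap form holds at `N(θ)` with gap `g/2`. [folklore — Kato II-§5] -/
theorem eventually_top_eigenpair {S : ℝ → Matrix (Fin 3) (Fin 3) ℝ}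
    (hS : ∀ i j, ContDiff ℝ ∞ fun θ => S θ i j) (hsymm : ∀ θ, (S θ).IsSymm) {θ₀ : ℝ}
    {e : Fin 3 → ℝ} {lam g : ℝ} (he1 : e ⬝ᵥ e = 1) (hSe : S θ₀ *ᵥ e = lam • e) (hg : 0 < g)
    (hgap : ∀ v, v ⬝ᵥ e = 0 → v ⬝ᵥ S θ₀ *ᵥ v ≤ (lam - g) * (v ⬝ᵥ v))
    {N : ℝ → Fin 3 → ℝ} {Λ : ℝ → ℝ} (hN : ContDiffAt ℝ ∞ N θ₀) (hΛ : ContDiffAt ℝ ∞ Λ θ₀)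
    (hN0 : N θ₀ = e) (hΛ0 : Λ θ₀ = lam)
    (hev : ∀ᶠ θ in 𝓝 θ₀, S θ *ᵥ N θ = Λ θ • N θ ∧ N θ ⬝ᵥ N θ = 1) :
    ∀ᶠ θ in 𝓝 θ₀, lam1 (S θ) = Λ θ ∧ N θ ∈ topEigSet (flat (S θ)) ∧
      ∀ w, w ⬝ᵥ N θ = 0 → w ⬝ᵥ S θ *ᵥ w ≤ (Λ θ - g / 2) * (w ⬝ᵥ w) := by
  -- (1) `Λ` close to `λ`
  have hΛc : ContinuousAt Λ θ₀ := hΛ.continuousAt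
  have h1 : ∀ᶠ θ in 𝓝 θ₀, |Λ θ - lam| < g / 8 := by
    have h := hΛc.eventually (Metric.ball_mem_nhds (Λ θ₀) (by positivity : (0 : ℝ) < g / 8))
    filter_upwards [h] with θ hθ
    rw [Real.dist_eq, hΛ0] at hθ
    exact hθ
  -- (2) entrywise closeness of `S`
  have hF : ContinuousAt (fun θ => ∑ i, ∑ j, |S θ i j - S θ₀ i j|) θ₀ :=
    (continuous_finsetSum _ fun i _ => continuous_finsetSum _ fun j _ =>
      (((hS i j).continuous).sub continuous_const).abs).continuousAt
  have h2 : ∀ᶠ θ in 𝓝 θ₀, ∑ i, ∑ j, |S θ i j - S θ₀ i j| < g / 8 := by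
    have h := hF.eventually (Metric.ball_mem_nhds _ (by positivity : (0 : ℝ) < g / 8))
    filter_upwards [h] with θ hθ
    rw [Real.dist_eq] at hθ
    simp only [sub_self, abs_zero, Finset.sum_const_zero, sub_zero] at hθ
    have h0 : 0 ≤ ∑ i, ∑ j, |S θ i j - S θ₀ i j| :=
      Finset.sum_nonneg fun i _ => Finset.sum_nonneg fun j _ => abs_nonneg _
    rwa [abs_of_nonneg h0] at hθ
  -- (3) `N` close to `e`
  have hG : ContinuousAt (fun θ => (N θ - e) ⬝ᵥ (N θ - e)) θ₀ := by
    have hNc : ContinuousAt N θ₀ := hN.continuousAt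
    have h : Continuous fun p : (Fin 3 → ℝ) => (p - e) ⬝ᵥ (p - e) :=
      (continuous_id.sub continuous_const).dotProduct (continuous_id.sub continuous_const)
    exact h.continuousAt.comp hNc
  have h3 : ∀ᶠ θ in 𝓝 θ₀, (N θ - e) ⬝ᵥ (N θ - e) < 1 / 8 := by
    have h := hG.eventually (Metric.ball_mem_nhds _ (by norm_num : (0 : ℝ) < 1 / 8))
    filter_upwards [h] with θ hθ
    rw [Real.dist_eq, hN0, sub_self] at hθ
    simp only [dotProduct_zero, sub_zero] at hθ
    exact lt_of_abs_lt hθ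
  filter_upwards [h1, h2, h3, hev] with θ hθ1 hθ2 hθ3 hθ4
  obtain ⟨hSN, hN1⟩ := hθ4
  -- the form bound `wᵀ(S θ − S θ₀)w ≤ η |w|²`
  have hη : ∀ w : Fin 3 → ℝ, w ⬝ᵥ (S θ - S θ₀) *ᵥ w ≤ (g / 8) * (w ⬝ᵥ w) := by
    intro w
    have h := abs_ray_le_sum_abs (S θ - S θ₀) w
    simp only [Matrix.sub_apply] at h
    exact (le_abs_self _).trans (h.trans (mul_le_mul_of_nonneg_right hθ2.le (dotProduct_self_nonneg' w)))
  have hle : lam - g + g * (1 / 8) + g / 8 ≤ Λ θ := by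
    have := (abs_lt.1 hθ1).1
    linarith
  obtain ⟨hlam1, htop, hgap'⟩ := lam1_eq_of_near (hsymm θ₀) (hsymm θ) he1 hSe hg.le hgap hN1 hSN hη
    hθ3.le hle
  refine ⟨hlam1, htop, fun w hw => ?_⟩
  have h := hgap' w hw
  have hθ1' := (abs_lt.1 hθ1).1
  nlinarith [h, dotProduct_self_nonneg' w, hθ1']

/-- **PROPOSITION 3 ALONG A LINE FOR `λ₁` ITSELF.** Let `S : ℝ → Mat₃(ℝ)` be entrywise `C^∞` and
symmetric with a simple top at `θ₀` in gap form (`S(θ₀)e = λe`, `|e| = 1`,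
`vᵀS(θ₀)v ≤ (λ − g)|v|²` on `e^⊥`, `g > 0`). Then `θ ↦ λ₁(S(θ))` coincides near `θ₀` with the `C^∞`
continued eigenvalue `Λ`, so it has derivative `eᵀS′(θ₀)e` at `θ₀` (Hellmann–Feynman for `λ₁`) and
its derivative has derivative `eᵀS″(θ₀)e + 2N′ᵀS′(θ₀)e` there, with the channel
`N′ᵀS′e = λ|N′|² − N′ᵀS(θ₀)N′ ≥ 0`. [ours; F1 PART I Prop. 3] -/
theorem hasDerivAt_lam1_of_gapForm {S : ℝ → Matrix (Fin 3) (Fin 3) ℝ}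
    (hS : ∀ i j, ContDiff ℝ ∞ fun θ => S θ i j) (hsymm : ∀ θ, (S θ).IsSymm) {θ₀ : ℝ}
    {e : Fin 3 → ℝ} {lam g : ℝ} (he1 : e ⬝ᵥ e = 1) (hSe : S θ₀ *ᵥ e = lam • e) (hg : 0 < g)
    (hgap : ∀ v, v ⬝ᵥ e = 0 → v ⬝ᵥ S θ₀ *ᵥ v ≤ (lam - g) * (v ⬝ᵥ v)) :
    ∃ (N : ℝ → Fin 3 → ℝ), ContDiffAt ℝ ∞ N θ₀ ∧ N θ₀ = e ∧
      (∀ᶠ θ in 𝓝 θ₀, N θ ∈ topEigSet (flat (S θ))) ∧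
      ContDiffAt ℝ ∞ (fun θ => lam1 (S θ)) θ₀ ∧
      HasDerivAt (fun θ => lam1 (S θ))
        (e ⬝ᵥ ((Matrix.of fun i j => deriv (fun t => S t i j) θ₀) *ᵥ e)) θ₀ ∧
      HasDerivAt (deriv fun θ => lam1 (S θ))
        (e ⬝ᵥ ((Matrix.of fun i j => deriv (deriv fun t => S t i j) θ₀) *ᵥ e) +
          2 * ((fun i => deriv (fun t => N t i) θ₀) ⬝ᵥ
            ((Matrix.of fun i j => deriv (fun t => S t i j) θ₀) *ᵥ e))) θ₀ ∧
      0 ≤ (fun i => deriv (fun t => N t i) θ₀) ⬝ᵥ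
          ((Matrix.of fun i j => deriv (fun t => S t i j) θ₀) *ᵥ e) := by
  obtain ⟨N, Λ, hN, hΛ, hN0, hΛ0, hev, hHF, h2, -, hsign⟩ :=
    hasDerivAt_top_eigenpair hS hsymm he1 hSe hg hgap
  have hpers := eventually_top_eigenpair hS hsymm he1 hSe hg hgap hN hΛ hN0 hΛ0 hev
  have heq : (fun θ => lam1 (S θ)) =ᶠ[𝓝 θ₀] Λ := hpers.mono fun θ h => h.1
  refine ⟨N, hN, hN0, hpers.mono fun θ h => h.2.1, hΛ.congr_of_eventuallyEq heq,
    hHF.congr_of_eventuallyEq heq, ?_, hsign⟩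
  -- the derivative functions agree near `θ₀` as well
  have heq' : deriv (fun θ => lam1 (S θ)) =ᶠ[𝓝 θ₀] deriv Λ := by
    filter_upwards [heq.eventually_nhds] with θ hθ
    exact Filter.EventuallyEq.deriv_eq (hθ : (fun θ => lam1 (S θ)) =ᶠ[𝓝 θ] Λ)
  exact h2.congr_of_eventuallyEq heq'

end TopEig

end Summit.NavierStokesRegularity.FunctionalMining

end
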